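import Summits.BirchSwinnertonDyer.BirchSwinnertonDyer.Theorems.ManinLocalTwoThreeAtkinLehnerGenericPoints
import HarnessLib

/-!
# `2^{#S} ∣ deg φ` when the modular parametrisation is invariant under the Atkin–Lehner matrices `w(Q_p)`, `p ∈ S`
(kernel step (1c) of es's THEOREM L♮ / E-es-173♭ — Dummigan–Krishnamoorthy-type divisibility, fact-free; cell bsd-f2-manin, prover p2 gen 20;
`--supports stmt-BirchSwinnertonDyer-22967`)

`two_pow_card_dvd_modularDegree_of_φ_atkinLehnerW_smul`: let `D` be any modular parametrisation datum of `W` at level `N` and `S` a set of primes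
of `N`.  If `φ(w(Q_p)·τ) = φ(τ)` on `ℍ` for every `p ∈ S` (`Q_p = p^{v_p(N)}`), then `2^{#S} ∣ deg φ`.
PROOF.  The group `G = (ℤ/2)^S` acts on `Y₀(N)` by `g ↦ w(Q_{supp g})` (p2 g20 `AtkinLehnerOrbit`: symmetric-difference law) and preserves every fibre of
`φ` (invariance, `φ_atkinLehnerW_prodOrdProj_smul_of_forall`).  For a point `P ∈ E(ℂ)` outside the countable set `φ(bad locus) ∪ (deg_spec exceptions)`
(`AtkinLehnerGeneric`: fixed loci of the `w(Q)`, `Q ≠ 1`, on `Y₀(N)` are countable; `E(ℂ)` is uncountable) the fibre `F_P ⊆ Y₀(N)` is finite of size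
`deg φ` (`deg_spec`) and `G` acts FREELY on it; Burnside's count `Σ_g #Fix(g) = #orbits · #G` (`MulAction.sum_card_fixedBy_eq_card_orbits_mul_card_group`)
reads `#F_P = #orbits · 2^{#S}`.
HONEST FRAMING: this is the fact-free counting half of «Step (1)» of MEMO-es §57.11.2; the arithmetic input «`ε_Q = +1` and `E(ℚ)[2] = 0` ⟹ `φ∘w(Q) = φ`»
needs the rationality of `φ(cusp 1/(N/Q))` (printed, statement-only) and is NOT here; THEOREM L♮'s steps (2)–(5) are out of reach.  Nothing about C2,
Manin's conjecture or BSD is proved. [cite: AtkinLehner1970, Lemmas 8–10] [cite: DiamondShurman2005, §2.3 (shape)] [folklore]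
-/

set_option autoImplicit false
-- lint-debt: the directory name repeats the summit name (sibling precedent `ManinLocalTwoThreeAtkinLehnerOrbitAction.lean`)
set_option linter.dupNamespace false

noncomputable section

open scoped MatrixGroups ModularForm
open CongruenceSubgroup Matrix.SpecialLinearGroup UpperHalfPlane
open Literature.NumberTheory.EllipticCurves Literature.NumberTheory.EllipticCurves.ModularForms

namespace Summit.BirchSwinnertonDyer.BirchSwinnertonDyer.Theorems.ManinLocalTwoThree.AtkinLehnerOrbit

variable {N : ℕ} [NeZero N]

/-- In `ℤ/2`: `u + v = 1` iff exactly one of `u, v` is `1`. [folklore] -/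
theorem zmod_two_add_eq_one_iff (u v : ZMod 2) : u + v = 1 ↔ (u = 1 ∧ ¬ v = 1) ∨ (v = 1 ∧ ¬ u = 1) := by
  revert u v; decide

/-- In `ℤ/2`: `u ≠ 1 → u = 0`. [folklore] -/
theorem zmod_two_eq_zero_of_ne_one (u : ZMod 2) (h : u ≠ 1) : u = 0 := by
  revert u; decide

/-- **`2^{#S} ∣ deg φ` from `w(Q_p)`-invariance of `φ`, `p ∈ S`.**  See the module docstring. [cite: AtkinLehner1970, Lemmas 8–10] -/
theorem two_pow_card_dvd_modularDegree_of_φ_atkinLehnerW_smul {W : WeierstrassCurve ℚ} (D : ModularParametrizationData W N)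
    (S₀ : Finset ℕ) (hS₀ : S₀ ⊆ N.primeFactors)
    (hφ : ∀ p ∈ S₀, ∀ τ : ℍ, haveI : NeZero (p ^ N.factorization p) := ⟨(Nat.ordProj_pos N p).ne'⟩
      D.φ (glCast (atkinLehnerW N (p ^ N.factorization p) : GL (Fin 2) ℚ) • τ) = D.φ τ) :
    2 ^ S₀.card ∣ D.modularDegree := by
  classical
  -- the group `G = (ℤ/2)^{S₀}` and the supports
  let G := Multiplicative (↥S₀ → ZMod 2)
  let supp : G → Finset ℕ := fun g ↦
    (Finset.univ.filter fun i : ↥S₀ ↦ Multiplicative.toAdd g i = 1).map (Function.Embedding.subtype _)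
  have hsuppS : ∀ g, supp g ⊆ S₀ := fun g p hp ↦ by
    obtain ⟨i, -, rfl⟩ := Finset.mem_map.mp hp
    exact i.2
  have hsuppP : ∀ g, supp g ⊆ N.primeFactors := fun g ↦ (hsuppS g).trans hS₀
  have hmem_supp : ∀ (g : G) (i : ↥S₀), (i : ℕ) ∈ supp g ↔ Multiplicative.toAdd g i = 1 := fun g i ↦ by
    constructor
    · intro h
      obtain ⟨j, hj, hji⟩ := Finset.mem_map.mp h
      rw [Finset.mem_filter] at hj
      have : j = i := Subtype.ext hji
      rw [← this]
      exact hj.2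
    · intro h
      exact Finset.mem_map.mpr ⟨i, Finset.mem_filter.mpr ⟨Finset.mem_univ _, h⟩, rfl⟩
  have hsupp_one : supp 1 = ∅ := by
    ext p
    simp only [Finset.notMem_empty, iff_false]
    intro hp
    obtain ⟨i, hi, -⟩ := Finset.mem_map.mp hp
    rw [Finset.mem_filter] at hi
    exact zero_ne_one hi.2
  have hsupp_mul : ∀ g h : G, supp (g * h) = symmDiff (supp g) (supp h) := by
    intro g h
    ext p
    rw [Finset.mem_symmDiff]
    by_cases hp : p ∈ S₀
    · rw [hmem_supp (g * h) ⟨p, hp⟩, hmem_supp g ⟨p, hp⟩, hmem_supp h ⟨p, hp⟩, toAdd_mul, Pi.add_apply]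
      exact zmod_two_add_eq_one_iff _ _
    · constructor
      · intro h'
        exact absurd (hsuppS _ h') hp
      · rintro (⟨h', -⟩ | ⟨h', -⟩) <;> exact absurd (hsuppS _ h') hp
  have hsupp_ne : ∀ g : G, g ≠ 1 → (supp g).Nonempty := by
    intro g hg
    rw [Finset.nonempty_iff_ne_empty]
    intro hge
    apply hg
    apply Multiplicative.toAdd.injective
    funext i
    have hi : Multiplicative.toAdd g i ≠ 1 := fun h1 ↦ by
      have := (hmem_supp g i).mpr h1
      rw [hge] at this
      exact Finset.notMem_empty _ this
    rw [zmod_two_eq_zero_of_ne_one _ hi]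
    rfl
  -- the Atkin–Lehner matrix of `g`
  have hQpos : ∀ g : G, 0 < ∏ p ∈ supp g, p ^ N.factorization p := fun g ↦ prodOrdProj_pos _ (hsuppP g)
  let w : G → GL (Fin 2) ℝ := fun g ↦
    haveI : NeZero (∏ p ∈ supp g, p ^ N.factorization p) := ⟨(hQpos g).ne'⟩
    glCast (atkinLehnerW N (∏ p ∈ supp g, p ^ N.factorization p) : GL (Fin 2) ℚ)
  have hw1 : ∀ τ : ℍ, Y0.mk N (w 1 • τ) = Y0.mk N τ := by
    intro τ
    haveI : NeZero (∏ p ∈ supp 1, p ^ N.factorization p) := ⟨(hQpos 1).ne'⟩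
    have e : w 1 = glCast (atkinLehnerW N 1 : GL (Fin 2) ℚ) := atkinLehnerW_congr (by rw [hsupp_one, Finset.prod_empty])
    rw [e]
    exact y0mk_atkinLehnerW_one τ
  have hwmul : ∀ (g h : G) (τ : ℍ), Y0.mk N (w g • (w h • τ)) = Y0.mk N (w (g * h) • τ) := by
    intro g h τ
    haveI : NeZero (∏ p ∈ supp g, p ^ N.factorization p) := ⟨(hQpos g).ne'⟩
    haveI : NeZero (∏ p ∈ supp h, p ^ N.factorization p) := ⟨(hQpos h).ne'⟩
    haveI : NeZero (∏ p ∈ supp (g * h), p ^ N.factorization p) := ⟨(hQpos (g * h)).ne'⟩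
    haveI : NeZero (∏ p ∈ symmDiff (supp g) (supp h), p ^ N.factorization p) :=
      ⟨(prodOrdProj_pos _ fun p hp ↦ by
        rcases Finset.mem_symmDiff.mp hp with ⟨h', -⟩ | ⟨h', -⟩
        · exact hsuppP g h'
        · exact hsuppP h h').ne'⟩
    have e : w (g * h) = glCast (atkinLehnerW N (∏ p ∈ symmDiff (supp g) (supp h), p ^ N.factorization p) : GL (Fin 2) ℚ) :=
      atkinLehnerW_congr (by rw [hsupp_mul])
    rw [e]
    exact y0mk_atkinLehnerW_prodOrdProj_symmDiff (hsuppP g) (hsuppP h) τ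
  have hwcongr : ∀ (g : G) {τ τ' : ℍ}, Y0.mk N τ = Y0.mk N τ' → Y0.mk N (w g • τ) = Y0.mk N (w g • τ') := by
    intro g τ τ' hττ'
    haveI : NeZero (∏ p ∈ supp g, p ^ N.factorization p) := ⟨(hQpos g).ne'⟩
    exact y0mk_atkinLehnerW_smul_congr (prodOrdProj_dvd _ (hsuppP g)) (coprime_prodOrdProj _ (hsuppP g)) hττ'
  have hwφ : ∀ (g : G) (τ : ℍ), D.φ (w g • τ) = D.φ τ := by
    intro g τ
    haveI : NeZero (∏ p ∈ supp g, p ^ N.factorization p) := ⟨(hQpos g).ne'⟩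
    exact φ_atkinLehnerW_prodOrdProj_smul_of_forall D (supp g) (hsuppP g) (fun p hp ↦ hφ p (hsuppS g hp)) τ
  -- the bad locus and a generic point `P`
  set Bad : Set ℍ := {τ : ℍ | ∃ (S : Finset ℕ) (hS : S ⊆ N.primeFactors), S.Nonempty ∧
      haveI : NeZero (∏ p ∈ S, p ^ N.factorization p) := ⟨(prodOrdProj_pos S hS).ne'⟩
      Y0.mk N (glCast (atkinLehnerW N (∏ p ∈ S, p ^ N.factorization p) : GL (Fin 2) ℚ) • τ) = Y0.mk N τ} with hBad
  have hBadc : Bad.Countable := countable_setOf_exists_y0mk_atkinLehnerW_prodOrdProj_smul_eq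
  have hwBad : ∀ (g : G) (τ : ℍ), g ≠ 1 → Y0.mk N (w g • τ) = Y0.mk N τ → τ ∈ Bad := by
    intro g τ hg h
    exact ⟨supp g, hsuppP g, hsupp_ne g hg, h⟩
  set E₀ : Set (W.baseChange ℂ).toAffine.Point := {P | Nat.card {y : Y0 N // ∃ τ : ℍ, Y0.mk N τ = y ∧
      D.uniformize ((D.c : ℂ) * eichlerIntegral D.f τ) = P} ≠ D.deg} with hE₀
  have hE₀f : E₀.Finite := D.deg_spec
  obtain ⟨P, hP⟩ := exists_point_not_mem_of_countable D (hE₀f.countable.union (hBadc.image D.φ))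
  have hPdeg : Nat.card {y : Y0 N // ∃ τ : ℍ, Y0.mk N τ = y ∧ D.uniformize ((D.c : ℂ) * eichlerIntegral D.f τ) = P} = D.deg := by
    by_contra h
    exact hP (Or.inl h)
  have hPbad : ∀ τ ∈ Bad, D.φ τ ≠ P := fun τ hτ h ↦ hP (Or.inr ⟨τ, hτ, h⟩)
  -- the fibre and the action of `G` on it
  let F := {y : Y0 N // ∃ τ : ℍ, Y0.mk N τ = y ∧ D.uniformize ((D.c : ℂ) * eichlerIntegral D.f τ) = P}
  let rep : F → ℍ := fun y ↦ Classical.choose y.2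
  have hrep : ∀ y : F, Y0.mk N (rep y) = y.1 ∧ D.φ (rep y) = P := fun y ↦ Classical.choose_spec y.2
  let act : G → F → F := fun g y ↦ ⟨Y0.mk N (w g • rep y), w g • rep y, rfl, by
    show D.φ (w g • rep y) = P
    rw [hwφ, (hrep y).2]⟩
  letI : MulAction G F :=
    { smul := act
      one_smul := fun y ↦ Subtype.ext (by
        show Y0.mk N (w 1 • rep y) = y.1
        rw [hw1, (hrep y).1])
      mul_smul := fun g h y ↦ Subtype.ext (by
        show Y0.mk N (w (g * h) • rep y) = Y0.mk N (w g • rep (act h y))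
        rw [← hwmul, hwcongr g (hrep (act h y)).1]) }
  have hsmul_val : ∀ (g : G) (y : F), (g • y).1 = Y0.mk N (w g • rep y) := fun _ _ ↦ rfl
  -- finiteness and freeness
  have hFin : Finite F := Nat.finite_of_card_ne_zero (by rw [hPdeg]; exact D.deg_pos.ne')
  letI : Fintype F := Fintype.ofFinite F
  have hfree : ∀ g : G, g ≠ 1 → ∀ y : F, g • y ≠ y := by
    intro g hg y hgy
    have h1 : Y0.mk N (w g • rep y) = Y0.mk N (rep y) := by rw [← hsmul_val, hgy, (hrep y).1]
    exact hPbad _ (hwBad g (rep y) hg h1) (hrep y).2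
  -- Burnside's count
  have hB := MulAction.sum_card_fixedBy_eq_card_orbits_mul_card_group G F
  have hsum : (∑ g : G, Fintype.card (MulAction.fixedBy F g)) = Fintype.card F := by
    rw [Finset.sum_eq_single (1 : G)]
    · refine Fintype.card_congr ((Equiv.setCongr ?_).trans (Equiv.Set.univ F))
      ext y
      simp
    · intro g _ hg
      exact Fintype.card_eq_zero_iff.mpr ⟨fun y ↦ hfree g hg y.1 y.2⟩
    · intro h
      exact absurd (Finset.mem_univ _) h
  rw [hsum] at hB
  have hG : Fintype.card G = 2 ^ S₀.card := by
    rw [Fintype.card_multiplicative, Fintype.card_fun, ZMod.card, Fintype.card_coe]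
  have hF : Fintype.card F = D.deg := by rw [← Nat.card_eq_fintype_card, hPdeg]
  rw [ModularParametrizationData.modularDegree, ← hF, hB, ← hG]
  exact Dvd.intro_left _ rfl

end Summit.BirchSwinnertonDyer.BirchSwinnertonDyer.Theorems.ManinLocalTwoThree.AtkinLehnerOrbit

end
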